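/-
Copyright (c) 2026 the pub-hodgecm-mathlib formalisation cell (harness21).  Prover seat hodgecm-mathlib-LH4-p14 (g3): Track A «(D-RAM) FOUR-FRAME» squad of crux H413, unit U2H (ii-H),
(ρ2b′-X) payer of record — FOURTH ASSEMBLY LAYER: the literal census (ρ2b′-XLit) from the SIGNED-CENSUS ORGAN PACKAGE (payer ORDER v1 b16823cc §B), 2026-09-04.
-/
import Summits.HodgeConjecture.HodgeConjecture.Theorems.F0P3cDyRamFixedPointCensusTypeTwoLiterals   -- ★ p857104∕p857119 (this seat): layers 3∕3′ (`latticeCensus_of_literals`); brings every token of :418 and layer 1 ★ p857061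
import HarnessLib

/-!
# F0 · P3c · line LH4 «(D-RAM) FOUR-FRAME» — unit (ii-H), leaf (ρ2b′-X): THE LITERAL CENSUS FROM THE SIGNED-CENSUS ORGAN PACKAGE (integer interface of the toric census)
(Rogawski 1990 §4.9 Prop. 4.9.1 (b), Lemma 4.9.3; Labesse–Langlands 1979 §2; Kottwitz 1986 §1)

Cell `pub/hodgecm-mathlib`, crux H413 = `stmt-HodgeConjecture-24833` (helper lane, count-neutral); THEOREMS ONLY (no definition, no instance, no notation, no named fact, no `sorry`,
default heartbeats), typed under the LINE FILE's scopes.  Socket served: (ρ2b′-XLit) = the hypothesis of ★ `F0P3cDyRamFixedPointCensusTypeTwoLiterals.latticeCensus_of_literals`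
(layer 3′, p857119; socket text `F0/P3c/LH4/LH4-p14/g3/RHO2BX-XLit.socket.v1.LH4p14g3.txt` ebb82b82), itself paying (ρ2b′-X) :418 through ★ layer 1 p857061.

WHAT IS PROVED (arithmetic bookkeeping over `ℂ`; no census mathematics): **`latticeCensus_literals_of_signedCensus (hOrg) : (ρ2b′-XLit)`** where `hOrg` — THE ORGAN PACKAGE — says:
`q_v = q_w` (residue degree one at the ramified place) and, near `1 ∈ H_v`, every `G`-regular type-(2) `γ_H` carries
* (O-Lit) two matches `t_h`, `t_a` (print: the HYPERBOLIC-frame and the ANISOTROPIC-frame block literals) with `κ_v(γ_H, t_h) = s_y`, `κ_v(γ_H, t_a) = −s_y`, `s_y ∈ {±1}`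
  (tame ★ `TypeTwoRamifiedFrameLiteral`: `s_y = (y_λ, θ)_v`; wild ★ p857204 `F0P3cDyRamTypeTwoLiteralSignWild`);
* (O-Glue ∘ T3 ∘ T5 ∘ T5s) THE SIGNED TORIC CENSUS in integers: `(q_w − 1)·(N t_h − N t_a) = ε_t·q_w^m′·((q_w + 1)·q_w^{n_H} − 2·q_w^S)`, `S = shiftR d t_E`, `ε_t ∈ {±1}` the side
  carrying the top cells, `m′` the depth token and `n_H` the H-level of `γ_H` (★ T2a∕T2b p857187∕p857229 glue fibre, ★ T3-T p857203∕p857215, DEFS leaf + T5a∕b∕c sheets, T5s);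
* (O-Hside) `(q_w − 1)·(#Fix_{γ₂}(U₂ ⧸ K₂) + d % 2) + 2 = (q_w + 1)·q_w^{n_H}` (★ p856225 §3 + ★ `SLTwoTreeFixedSubtreeCount` §2 + the descent level sentence of T3-E);
* (tokens ∕ O-Sign) for all tokens `(m, β)` of :418: `m = m′` and `(β, θ)_v·s_y = ε_t` (the deep sign law: the top cells sit on the `κ = (β,θ)_v` side; FLIP-PREDICATE memo LH4-p12 (g3)).
PROOF: order the pair by `s_y` (`(t₀, t₁) := (t_h, t_a)` if `s_y = 1`, else `(t_a, t_h)`), divide the census by `q_w − 1 ≠ 0` and `q_w^{m} ≠ 0`, and use `(β,θ)_v·s_y·ε_t = ε_t² = 1`.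

HONEST LABEL: HC_CM is proved only modulo the 7 printed citations (2 remaining named inputs: hLiu418 = stmt-HodgeConjecture-24832, h413 = stmt-HodgeConjecture-24833) until rung 0
closes; this file is a reduction (count-neutral) — `hOrg` is the OPEN organ package of the payer ORDER; nothing in it is asserted here.

## References
* [Rogawski1990] J. D. Rogawski, *Automorphic Representations of Unitary Groups in Three Variables*, Ann. of Math. Stud. 123 (1990), §4.9 Prop. 4.9.1 (b) p. 55, Lemma 4.9.3 p. 56; §4.3 (4.3.2) p. 43.
* [LabesseLanglands1979] J.-P. Labesse, R. P. Langlands, *L-indistinguishability for SL(2)*, Canad. J. Math. 31 (1979), §2 p. 8.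
* [Kottwitz1986BaseChangeUnits] R. E. Kottwitz, *Base change for unit elements of Hecke algebras*, Compositio Math. 60 (1986), §1 pp. 240–241.
-/

set_option autoImplicit false

noncomputable section

namespace Summit.HodgeConjecture.HodgeConjecture.Cruxes.H413.F0P3cDyRamFixedPointCensusTypeTwoSignedCensus

-- THE LINES MODULE'S `open` CONTEXT (tree `Cruxes/H413/Lines/F0_P3c_DyRamFourFrame_U2H_HSide.lean`, after its `namespace`):
open MeasureTheory Measure NumberField IsDedekindDomain Topology Filter
open Literature.NumberTheory.Automorphic Literature.NumberTheory.Automorphic.UnitaryGroup Literature.NumberTheory.Automorphic.IntegralReduction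
open Literature.NumberTheory.Rogawski1990 Literature.NumberTheory.GaloisRepresentations
open Literature.NumberTheory.Automorphic.UnitaryThreeFourFrame
open Summit.HodgeConjecture.HodgeConjecture.Cruxes.H413.F0P3cDyRamFourFrameHSideDefs
open Summit.HodgeConjecture.HodgeConjecture.Cruxes.H413.F0P3cDyRamFourFrameHFamilyDefs
open scoped Matrix MatrixGroups Classical ValuativeRel
open Summit.HodgeConjecture.HodgeConjecture.Cruxes.H413.F0P3cDyRamFourFrameHSideDefsR
open Summit.HodgeConjecture.HodgeConjecture.Cruxes.H413.F0P3cDyRamFourFrameLawDefsR (shiftT shiftR)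
open Literature.NumberTheory.Automorphic.UnitaryLatticeTree Literature.NumberTheory.Automorphic.HermitianLattice

/-- The arithmetic core: from `(Q−1)(N_h − N_a) = ε_t·Q^m·((Q+1)Q^{n} − 2Q^S)`, `(Q−1)(F + D) + 2 = (Q+1)Q^{n}`, `ε_t² = 1` and `H·X = ε_t·(N_h − N_a)` conclude
`H·Q^{−m}·X = (F + D) − 2(Q^S − 1)∕(Q − 1)`. [cite: Rogawski1990, §4.9 Lemma 4.9.3 p. 56] -/
theorem census_core {Q Nh Na F D et H X : ℂ} {m n S : ℕ} (hQ1 : Q - 1 ≠ 0) (hQ0 : Q ≠ 0) (het2 : et * et = 1)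
    (hG : (Q - 1) * (Nh - Na) = et * Q ^ m * ((Q + 1) * Q ^ n - 2 * Q ^ S)) (hH : (Q - 1) * (F + D) + 2 = (Q + 1) * Q ^ n)
    (hX : H * X = et * (Nh - Na)) :
    H * (Q ^ m)⁻¹ * X = (F + D) - 2 * (Q ^ S - 1) / (Q - 1) := by
  have hpow : Q ^ m ≠ 0 := pow_ne_zero _ hQ0
  have hNN : Nh - Na = et * Q ^ m * ((Q + 1) * Q ^ n - 2 * Q ^ S) / (Q - 1) := by
    rw [eq_div_iff hQ1]; linear_combination hG
  have h1 : H * (Q ^ m)⁻¹ * X = (Q ^ m)⁻¹ * (et * (Nh - Na)) := by rw [← hX]; ring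
  have h2 : (Q ^ m)⁻¹ * (et * (Nh - Na)) = ((Q + 1) * Q ^ n - 2 * Q ^ S) / (Q - 1) := by
    rw [hNN, show (Q ^ m)⁻¹ * (et * (et * Q ^ m * ((Q + 1) * Q ^ n - 2 * Q ^ S) / (Q - 1))) =
      (et * et) * ((Q ^ m)⁻¹ * Q ^ m) * (((Q + 1) * Q ^ n - 2 * Q ^ S) / (Q - 1)) by ring, het2, inv_mul_cancel₀ hpow, one_mul, one_mul]
  rw [h1, h2, eq_sub_iff_add_eq, ← add_div, div_eq_iff hQ1]
  linear_combination hH.symm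

/-- **(ρ2b′-XLit) FROM THE SIGNED-CENSUS ORGAN PACKAGE** — see the module docstring for the four organs inside `hOrg`.  Pure arithmetic: order the literal pair by the sign `s_y`
of the hyperbolic literal, cancel `q_w − 1` and `q_w^m`, and use `(β,θ)_v·s_y·ε_t = 1`.
[cite: Rogawski1990, §4.9 Prop. 4.9.1 (b) p. 55, Lemma 4.9.3 p. 56; §4.3 (4.3.2) p. 43] [cite: LabesseLanglands1979, §2 p. 8] [cite: Kottwitz1986BaseChangeUnits, §1 pp. 240–241] -/
theorem latticeCensus_literals_of_signedCensus
    (hOrg :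
        ∀ (L : Type) [Field L] [NumberField L] [IsCMField L]
        {v : HeightOneSpectrum (𝓞 ↥(maximalRealSubfield L))} (w : UnitaryGroup.PlacesOver L v)
        (hw : IsCMField.complexConj L • w.1 = w.1) (_he : v.asIdeal.ramificationIdx' w.1.asIdeal ≠ 1)
        (_h2 : ¬ IsUnit (2 : 𝒪[w.1.adicCompletion L]))
        (ϖ : (w.1.adicCompletion L)) (_hϖ : Valued.v ϖ = WithZero.exp (-1 : ℤ)) (d tE : ℕ) (_hD : IsRamifiedQuadraticDatum (galAdicCompletionMap (L := L) (IsCMField.complexConj L) hw) ϖ d tE)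
        [Fintype (Valued.ResidueField (w.1.adicCompletion L))],
        (Nat.card (𝓞 ↥(maximalRealSubfield L) ⧸ v.asIdeal)) = (Fintype.card (Valued.ResidueField (w.1.adicCompletion L))) ∧
        ∃ V ∈ 𝓝 (1 : ((UnitaryGroup.cmDatum L 2 (Matrix.of fun i j : Fin 2 => if i.val + j.val + 1 = 2 then (1 : L) else 0)).Local v × (UnitaryGroup.cmDatum L 1 (Matrix.of fun i j : Fin 1 => if i.val + j.val + 1 = 1 then (1 : L) else 0)).Local v)), ∀ γH ∈ V, IsLocalGRegular L v γH →
        ¬ (∃ x : (w.1.adicCompletion L), (((((γH).1.val : GL (Fin 2) (UnitaryGroup.LocalRing L v)).val.map (Pi.evalRingHom (fun w' : UnitaryGroup.PlacesOver L v => w'.1.adicCompletion L) w))).charpoly).IsRoot x) →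
        ∃ (th ta : ((UnitaryGroup.cmDatum L 3 (Matrix.of fun i j : Fin 3 => if i.val + j.val + 1 = 3 then (1 : L) else 0)).Local v)) (sy et : ℤ) (mm nH : ℕ),
          IsLocalNormPair L (Matrix.of fun i j : Fin 3 => if i.val + j.val + 1 = 3 then (1 : L) else 0) v γH th ∧ IsLocalNormPair L (Matrix.of fun i j : Fin 3 => if i.val + j.val + 1 = 3 then (1 : L) else 0) v γH ta ∧ finKappaAt L v (Matrix.of fun i j : Fin 3 => if i.val + j.val + 1 = 3 then (1 : L) else 0) γH th = sy ∧ finKappaAt L v (Matrix.of fun i j : Fin 3 => if i.val + j.val + 1 = 3 then (1 : L) else 0) γH ta = -sy ∧ (sy = 1 ∨ sy = -1) ∧ (et = 1 ∨ et = -1) ∧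
          (((Fintype.card (Valued.ResidueField (w.1.adicCompletion L))) : ℤ) - 1) * ((({M : Submodule (Valued.integer (w.1.adicCompletion L)) (Fin 3 → (w.1.adicCompletion L)) | IsVertexLattice (galAdicCompletionMap (L := L) (IsCMField.complexConj L) hw) ϖ ((StdForm.antidiagonal 3).over (w.1.adicCompletion L)) 0 M ∧ mapGL ((localNonsplitEquiv (IsCMField.complexConj L) (Matrix.of fun i j : Fin 3 => if i.val + j.val + 1 = 3 then (1 : L) else 0) (IsCMField.complexConj_ne_one L) w hw th : ↥(unitaryGroupOfForm (galAdicCompletionMap (L := L) (IsCMField.complexConj L) hw) (placeForm (Matrix.of fun i j : Fin 3 => if i.val + j.val + 1 = 3 then (1 : L) else 0) w.1))) : GL (Fin 3) (w.1.adicCompletion L)) M = M}.ncard : ℕ) : ℤ) - (({M : Submodule (Valued.integer (w.1.adicCompletion L)) (Fin 3 → (w.1.adicCompletion L)) | IsVertexLattice (galAdicCompletionMap (L := L) (IsCMField.complexConj L) hw) ϖ ((StdForm.antidiagonal 3).over (w.1.adicCompletion L)) 0 M ∧ mapGL ((localNonsplitEquiv (IsCMField.complexConj L) (Matrix.of fun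 i j : Fin 3 => if i.val + j.val + 1 = 3 then (1 : L) else 0) (IsCMField.complexConj_ne_one L) w hw ta : ↥(unitaryGroupOfForm (galAdicCompletionMap (L := L) (IsCMField.complexConj L) hw) (placeForm (Matrix.of fun i j : Fin 3 => if i.val + j.val + 1 = 3 then (1 : L) else 0) w.1))) : GL (Fin 3) (w.1.adicCompletion L)) M = M}.ncard : ℕ) : ℤ)) = et * ((Fintype.card (Valued.ResidueField (w.1.adicCompletion L))) : ℤ) ^ mm * ((((Fintype.card (Valued.ResidueField (w.1.adicCompletion L))) : ℤ) + 1) * ((Fintype.card (Valued.ResidueField (w.1.adicCompletion L))) : ℤ) ^ nH - 2 * ((Fintype.card (Valued.ResidueField (w.1.adicCompletion L))) : ℤ) ^ (d - d % 2)) ∧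
          (((Fintype.card (Valued.ResidueField (w.1.adicCompletion L))) : ℤ) - 1) * (((Nat.card (MulAction.fixedBy (((UnitaryGroup.cmDatum L 2 (Matrix.of fun i j : Fin 2 => if i.val + j.val + 1 = 2 then (1 : L) else 0)).Local v) ⧸ cmLocalIntegralLevel L 2 (Matrix.of fun i j : Fin 2 => if i.val + j.val + 1 = 2 then (1 : L) else 0) v) γH.1)) : ℤ) + (d % 2 : ℕ)) + 2 = (((Fintype.card (Valued.ResidueField (w.1.adicCompletion L))) : ℤ) + 1) * ((Fintype.card (Valued.ResidueField (w.1.adicCompletion L))) : ℤ) ^ nH ∧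
          (∀ (m : ℕ) (β : (v.adicCompletion ↥(maximalRealSubfield L))ˣ), Valued.v (((finCharpolyTwo L v γH).eval (finGammaTwo L v γH)) w) = Valued.v ((toPlace v w (HeckeCharacter.uniformizer ↥(maximalRealSubfield L) v : v.adicCompletion ↥(maximalRealSubfield L))) ^ m) →
            toPlace v w (β : v.adicCompletion ↥(maximalRealSubfield L)) = -(((finCharpolyTwo L v γH).eval (finGammaTwo L v γH)) w * (finGammaTwo L v γH w ^ 2 + ((γH.1.val.val : Matrix (Fin 2) (Fin 2) (UnitaryGroup.LocalRing L v)).map (Pi.evalRingHom (fun w' : UnitaryGroup.PlacesOver L v => w'.1.adicCompletion L) w)).det)) / (2 * finGammaTwo L v γH w ^ 2 * ((γH.1.val.val : Matrix (Fin 2) (Fin 2) (UnitaryGroup.LocalRing L v)).map (Pi.evalRingHom (fun w' : UnitaryGroup.PlacesOver L v => w'.1.adicCompletion L) w)).det) →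
            m = mm ∧ (Literature.NumberTheory.QuadraticForms.hilbertSymbol (v.adicCompletion ↥(maximalRealSubfield L)) (β : v.adicCompletion ↥(maximalRealSubfield L)) (algebraMap ↥(maximalRealSubfield L) _ ((cmQuadraticGenerator L : 𝓞 ↥(maximalRealSubfield L)) : ↥(maximalRealSubfield L))) : ℂ) * (sy : ℂ) = (et : ℂ))) :
    ∀ (L : Type) [Field L] [NumberField L] [IsCMField L]
    {v : HeightOneSpectrum (𝓞 ↥(maximalRealSubfield L))} (w : UnitaryGroup.PlacesOver L v)
    (hw : IsCMField.complexConj L • w.1 = w.1) (_he : v.asIdeal.ramificationIdx' w.1.asIdeal ≠ 1)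
    (_h2 : ¬ IsUnit (2 : 𝒪[w.1.adicCompletion L]))
    (ϖ : (w.1.adicCompletion L)) (_hϖ : Valued.v ϖ = WithZero.exp (-1 : ℤ)) (d tE : ℕ) (_hD : IsRamifiedQuadraticDatum (galAdicCompletionMap (L := L) (IsCMField.complexConj L) hw) ϖ d tE)
    [Fintype (Valued.ResidueField (w.1.adicCompletion L))],
    ∃ V ∈ 𝓝 (1 : ((UnitaryGroup.cmDatum L 2 (Matrix.of fun i j : Fin 2 => if i.val + j.val + 1 = 2 then (1 : L) else 0)).Local v × (UnitaryGroup.cmDatum L 1 (Matrix.of fun i j : Fin 1 => if i.val + j.val + 1 = 1 then (1 : L) else 0)).Local v)), ∀ γH ∈ V, IsLocalGRegular L v γH →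
    ¬ (∃ x : (w.1.adicCompletion L), (((((γH).1.val : GL (Fin 2) (UnitaryGroup.LocalRing L v)).val.map (Pi.evalRingHom (fun w' : UnitaryGroup.PlacesOver L v => w'.1.adicCompletion L) w))).charpoly).IsRoot x) →
    ∃ t₀ t₁ : ((UnitaryGroup.cmDatum L 3 (Matrix.of fun i j : Fin 3 => if i.val + j.val + 1 = 3 then (1 : L) else 0)).Local v), IsLocalNormPair L (Matrix.of fun i j : Fin 3 => if i.val + j.val + 1 = 3 then (1 : L) else 0) v γH t₀ ∧ finKappaAt L v (Matrix.of fun i j : Fin 3 => if i.val + j.val + 1 = 3 then (1 : L) else 0) γH t₀ = 1 ∧ IsLocalNormPair L (Matrix.of fun i j : Fin 3 => if i.val + j.val + 1 = 3 then (1 : L) else 0) v γH t₁ ∧ finKappaAt L v (Matrix.of fun i j : Fin 3 => if i.val + j.val + 1 = 3 then (1 : L) else 0) γH t₁ = -1 ∧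
    ∀ (m : ℕ) (β : (v.adicCompletion ↥(maximalRealSubfield L))ˣ), Valued.v (((finCharpolyTwo L v γH).eval (finGammaTwo L v γH)) w) = Valued.v ((toPlace v w (HeckeCharacter.uniformizer ↥(maximalRealSubfield L) v : v.adicCompletion ↥(maximalRealSubfield L))) ^ m) →
    toPlace v w (β : v.adicCompletion ↥(maximalRealSubfield L)) = -(((finCharpolyTwo L v γH).eval (finGammaTwo L v γH)) w * (finGammaTwo L v γH w ^ 2 + ((γH.1.val.val : Matrix (Fin 2) (Fin 2) (UnitaryGroup.LocalRing L v)).map (Pi.evalRingHom (fun w' : UnitaryGroup.PlacesOver L v => w'.1.adicCompletion L) w)).det)) / (2 * finGammaTwo L v γH w ^ 2 * ((γH.1.val.val : Matrix (Fin 2) (Fin 2) (UnitaryGroup.LocalRing L v)).map (Pi.evalRingHom (fun w' : UnitaryGroup.PlacesOver L v => w'.1.adicCompletion L) w)).det) →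
    (Literature.NumberTheory.QuadraticForms.hilbertSymbol (v.adicCompletion ↥(maximalRealSubfield L)) (β : v.adicCompletion ↥(maximalRealSubfield L)) (algebraMap ↥(maximalRealSubfield L) _ ((cmQuadraticGenerator L : 𝓞 ↥(maximalRealSubfield L)) : ↥(maximalRealSubfield L))) : ℂ) * (((Nat.card (𝓞 ↥(maximalRealSubfield L) ⧸ v.asIdeal) : ℂ) ^ m))⁻¹ *
    ((({M : Submodule (Valued.integer (w.1.adicCompletion L)) (Fin 3 → (w.1.adicCompletion L)) | IsVertexLattice (galAdicCompletionMap (L := L) (IsCMField.complexConj L) hw) ϖ ((StdForm.antidiagonal 3).over (w.1.adicCompletion L)) 0 M ∧ mapGL ((localNonsplitEquiv (IsCMField.complexConj L) (Matrix.of fun i j : Fin 3 => if i.val + j.val + 1 = 3 then (1 : L) else 0) (IsCMField.complexConj_ne_one L) w hw t₀ : ↥(unitaryGroupOfForm (galAdicCompletionMap (L := L) (IsCMField.complexConj L) hw) (placeForm (Matrix.of fun i j : Fin 3 => if i.val + j.val + 1 = 3 then (1 : L) else 0) w.1))) : GL (Fin 3) (w.1.adicCompletion L)) M = M}.ncard :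 ℕ) : ℂ) - (({M : Submodule (Valued.integer (w.1.adicCompletion L)) (Fin 3 → (w.1.adicCompletion L)) | IsVertexLattice (galAdicCompletionMap (L := L) (IsCMField.complexConj L) hw) ϖ ((StdForm.antidiagonal 3).over (w.1.adicCompletion L)) 0 M ∧ mapGL ((localNonsplitEquiv (IsCMField.complexConj L) (Matrix.of fun i j : Fin 3 => if i.val + j.val + 1 = 3 then (1 : L) else 0) (IsCMField.complexConj_ne_one L) w hw t₁ : ↥(unitaryGroupOfForm (galAdicCompletionMap (L := L) (IsCMField.complexConj L) hw) (placeForm (Matrix.of fun i j : Fin 3 => if i.val + j.val + 1 = 3 then (1 : L) else 0) w.1))) : GL (Fin 3) (w.1.adicCompletion L)) M = M}.ncard : ℕ) : ℂ)) =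
    ((Nat.card (MulAction.fixedBy (((UnitaryGroup.cmDatum L 2 (Matrix.of fun i j : Fin 2 => if i.val + j.val + 1 = 2 then (1 : L) else 0)).Local v) ⧸ cmLocalIntegralLevel L 2 (Matrix.of fun i j : Fin 2 => if i.val + j.val + 1 = 2 then (1 : L) else 0) v) γH.1) : ℂ) + ((d % 2 : ℕ) : ℂ)) - 2 * (((Fintype.card (Valued.ResidueField (w.1.adicCompletion L)) : ℕ) : ℂ) ^ (shiftR d tE) - 1) / (((Fintype.card (Valued.ResidueField (w.1.adicCompletion L)) : ℕ) : ℂ) - 1) := by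
  intro L _ _ _ v w hw he h2 ϖ hϖ d tE hD _
  obtain ⟨hq, V, hV, h⟩ := hOrg L w hw he h2 ϖ hϖ d tE hD
  refine ⟨V, hV, fun γH hγ hreg hirr => ?_⟩
  obtain ⟨th, ta, sy, et, mm, nH, hth, hta, hκh, hκa, hsy, het, hG, hH, htok⟩ := h γH hγ hreg hirr
  -- arithmetic facts on `q_w`
  have hq1 : 1 < Fintype.card (Valued.ResidueField (w.1.adicCompletion L)) := Fintype.one_lt_card
  have hQ1 : ((Fintype.card (Valued.ResidueField (w.1.adicCompletion L)) : ℕ) : ℂ) - 1 ≠ 0 := by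
    rw [sub_ne_zero]; exact_mod_cast hq1.ne'
  have hQ0 : ((Fintype.card (Valued.ResidueField (w.1.adicCompletion L)) : ℕ) : ℂ) ≠ 0 := by
    exact_mod_cast (by omega : Fintype.card (Valued.ResidueField (w.1.adicCompletion L)) ≠ 0)
  have hqv : ((Nat.card (𝓞 ↥(maximalRealSubfield L) ⧸ v.asIdeal) : ℂ)) = ((Fintype.card (Valued.ResidueField (w.1.adicCompletion L)) : ℕ) : ℂ) := by
    exact_mod_cast hq
  have hS : (((Fintype.card (Valued.ResidueField (w.1.adicCompletion L)) : ℕ) : ℂ)) ^ (shiftR d tE) =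
      (((Fintype.card (Valued.ResidueField (w.1.adicCompletion L)) : ℕ) : ℂ)) ^ (d - d % 2) := by
    rw [show shiftR d tE = ((d - d % 2 : ℕ) : ℤ) from rfl, zpow_natCast]
  have het2 : (et : ℂ) * et = 1 := by
    rcases het with rfl | rfl <;> norm_num
  have hGc := congrArg (Int.cast : ℤ → ℂ) hG
  have hHc := congrArg (Int.cast : ℤ → ℂ) hH
  push_cast at hGc hHc
  -- order the pair by the sign of the hyperbolic literal
  rcases hsy with rfl | rfl
  · refine ⟨th, ta, hth, by exact_mod_cast hκh, hta, by exact_mod_cast hκa, fun m β h1 h2' => ?_⟩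
    obtain ⟨rfl, hsign⟩ := htok m β h1 h2'
    rw [hqv, hS]
    rw [Int.cast_one, mul_one] at hsign
    exact census_core hQ1 hQ0 het2 hGc hHc (by rw [hsign])
  · refine ⟨ta, th, hta, ?_, hth, ?_, fun m β h1 h2' => ?_⟩
    · rw [hκa]; norm_num
    · exact_mod_cast hκh
    obtain ⟨rfl, hsign⟩ := htok m β h1 h2'
    rw [hqv, hS]
    rw [Int.cast_neg, Int.cast_one, mul_neg, mul_one] at hsign
    exact census_core hQ1 hQ0 het2 hGc hHc (by rw [← hsign]; ring)

end Summit.HodgeConjecture.HodgeConjecture.Cruxes.H413.F0P3cDyRamFixedPointCensusTypeTwoSignedCensus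

end
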